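import Summits.BirchSwinnertonDyer.BirchSwinnertonDyer.Theorems.KatoDescentPotSupersingularUnitIndexMuDoorsFukudaAt
import Summits.BirchSwinnertonDyer.BirchSwinnertonDyer.Theorems.KatoDescentPotSupersingularWildConjAResidueCartanRows06
import HarnessLib

/-!
# Route `KatoDescentPotSupersingular` (rung K9, sub-rung B5 = O6 wild `p = 3`, cell `bsd-potss`): the `GL₂(𝔽₃)`-image RESIDUE ROW `388800ho1` of the
# Conj-A crux `WildCoatesSujathaResidue` (19942; U₀-ns node 19189 → parent 19197 `WildUpperDefectRankZero`) — (A) / U₀ with the classical `μ`-hypothesis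
# DISCHARGED modulo Fukuda 1994 Thm. 1 (1) at layers `(1, 2)` of the cyclotomic `ℤ_3`-tower of `L_P = ℚ(E[3])^{U_P}`, from displayed PARI-computed layer
# data whose evidence needs NO degree-72 class group (door UG on the growing octic leaf + Kuroda)
# (seat `bsd-potss-k9-c4` g21, turnkey draft of g20; `--supports stmt-BirchSwinnertonDyer-19197 --as helper`; part 06 of `…WildConjAResidueUnitIndexRows0k`)

HONEST FRAMING. THEOREMS ONLY (no definition, no named fact, no `sorry`); PER ROW; nothing booked; items 19942 / 19189 / 19197 stay OPEN at class
level (open non-held input of the U₀ cone: the zeta crux 24327 `WildKatoZetaIndivisible`); Coates–Sujatha's (A), Conjecture A and BSD are proved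
for NO curve here.  CONDITIONAL on the named facts displayed as hypotheses (Lim 2017 Thm. 3.5 `hLim`, Fukuda 1994 Thm. 1 (1) `hF1`; for U₀ also
Kato's A161-fine `hKatoA`, GZK `hGZK`, modularity `hmod`) and on two displayed NUMERIC hypotheses about ONE explicit number field, the
unipotent-stabiliser field `L_P = ℚ(E[3])^{U_P}` (conjA-anchor g9; `= ℚ(P, ζ₃)` by the Weil pairing, identified on the certificate side as
`ℚ[x]/(x¹⁶+24x¹²+112x¹⁰+624x⁸+1344x⁶+1984x⁴+2688x²+2304)`, degree 16, k9-c4 g19 kit j308542):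
* `hram` — Fukuda's index is `0` on `L_P`: its four primes above `3` (`[e,f] = [6,1],[6,1],[2,1],[2,1]`) are totally ramified in the first
  cyclotomic layer (EXACT: `v ∣ rnfdisc(L_P, x³−3x+1)`, kit j308542);
* `hord` — `e₂(L_P) = e₁(L_P)` (both `= 1`).  EVIDENCE (not kernel-derived here; two tree theorems applied to PARI data):
  `L_P ⊇ k = ℚ(x(P)) = ℚ[x]/(x⁴−6x²−7x−3)` is biquadratic over `k` with the three octic intermediate fields `O₁ = x⁸+20x⁶−36x⁴+48x²−48`,
  `O_grow = ℚ(P) = x⁸−2x⁷+x⁶+56x⁵−130x⁴+146x³−114x²+48x−15`, `O₃ = x⁸−x⁷+x⁶−8x⁵+5x⁴−2x³+16x²−4x+1` (j308542), so Kuroda's relation up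
  the cyclotomic tower (tree theorem `IwasawaTheory.classNumberPExp_biquadratic_relation`, conjA-anchor g11) reads
  `e_n(L_P) + 2·e_n(k) = e_n(O₁) + e_n(O_grow) + e_n(O₃)` for every `n`; the leaves `k`, `O₁`, `O₃` PASS the unit norm-index door
  (j308542: `h = 1, 2, 2` CERTIFIED, `s = 2, 3, 2` primes above `3`, Fukuda index `0` exact, unit symbol ranks `1, 2, 1 = s − 1`), hence
  `e_n = 0` for all `n` there (tree theorem `forall_classicalMuVanishes_of_relIndex_mul_eq`, conjA-anchor g12: Chevalley ⟹ `A_n = 0`), so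
  `e_n(L_P) = e_n(O_grow)`; and `O_grow` PASSES the `e_n`-tolerant door UG at layers `(1,2)` (conjA-anchor g14 kit **j311095**: `F = O_grow,1`
  of degree 24 has `h = 6 = [6]` (GRH), `e₁ = 1`, `s = 3` primes above `3` with `[e,f] = [9,1],[9,1],[6,1]`, all three dividing
  `rnfdisc(F₂/F)` (`F₂ = F·ℚ(ζ₂₇)⁺`), prime classes of exponents `5, 1, 3` in `Cl(F) ≅ ℤ/6` spanning `Cl(F)/Cl(F)³`, unit norm symbols of rank
  `2 = s − 1`), hence `e₂(O_grow) = e₁(O_grow) = 1` by the KERNEL theorem `IwasawaTheory.classNumberPExp_succ_eq_of_sup_eq_top`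
  (`Literature/NumberTheory/IwasawaTheory/ClassicalMuVanishesUnitNormIndexGenerated.lean`, conjA-anchor g14).  Therefore
  `e₂(L_P) = e₁(L_P) = 1`.  GRH enters ONLY through `h(O_grow,1) = 6`.  CROSS-CHECK (pending at filing time): k9-c4 g19's kit j308794 computes
  `h(O_grow,2)` (degree 72) directly; UG predicts `e₂ = 1` there.
g19 (census v4.1): on `L_P` itself the unit-index door is SHUT (`s = 4`, symbol rank `2 < 3`) and Fukuda (0,1) is SHUT (`e₀ = 0 → e₁ = 1`); THIS
FILE uses Fukuda at `(1, 2)` through g19's door `UnitIndexMuDoors.missingUpperBoundAt_three_of_classNumberPExp_succ_eqAt_unipotentStabilizerField`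
(conjA-anchor g9's `Lim2017.fineSelmerDual_moduleFinite_of_classNumberPExp_succ_eq_unipotentStabilizerField` for (A)).  KERNEL row certificates
(k9-c4 g18 `…WildConjAResidueCartanRows06`, imported): `Δ ≠ 0`, global minimality, `E[3]` irreducible (Frobenius witness `ℓ = 7`), `ClassO6 E 3`
(wild: `f₃ = 5`).  With this file 24 of the 25 residue rows of 19942 carry an (A)/U₀ record with the `μ`-input discharged modulo named facts
(the 25th, 406593q1, waits on kit j309392 / UG-q1 j311971).

References: [Lim2017FineSelmer] §3 Thm. 3.5, Lemma 3.2; [Fukuda1994] Thm. 1 (1); [Lang1990] Ch. 13 §4 Lemma 4.1; [Lemmermeyer1994] §1 (Kuroda);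
[Kato2004Asterisque] Thm. 14.5 (3); [CoatesSujatha2005] Thm. 3.4; [Serre1972] §IV; [Cremona2006] Table 1.
-/

set_option linter.dupNamespace false
set_option autoImplicit false

noncomputable section

open scoped Classical NumberField
open WeierstrassCurve NumberField IsDedekindDomain Field IntermediateField
  Literature.NumberTheory.EllipticCurves Literature.NumberTheory.EllipticCurves.Rank1Residual
  Literature.NumberTheory.EllipticCurves.Rank1Residual.Typed
  Literature.NumberTheory.GaloisRepresentations Literature.NumberTheory.SerreUniformity Literature.NumberTheory.IwasawaTheory
  Summit.BirchSwinnertonDyer.Rank1Residual Summit.BirchSwinnertonDyer.Rank1Residual.Additive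
  Summit.BirchSwinnertonDyer.BirchSwinnertonDyer.Theorems

namespace Summit.BirchSwinnertonDyer.BirchSwinnertonDyer.Theorems.WildUpperUnitTwistRecords

/-! ### `388800ho1` @ `p = 3` (`GL₂(𝔽₃)` image, 9-deficient; NO Cartan road) — Fukuda `(1,2)` on `L_P = ℚ(E[3])^{U_P} = ℚ(P, ζ₃)` -/

/-- **(A) AT `(388800ho1, 3)` with the `μ`-hypothesis DISCHARGED by FUKUDA Thm. 1 (1) at layers `(1,2)` on `L_P = ℚ(E[3])^{U_P}`** (modulo the named facts
Lim 2017 Thm. 3.5 `hLim` and Fukuda `hF1`): `P` any geometric `3`-torsion point, displayed numerics on `L_P`: Fukuda index `0` (`hram`, exact: kit j308542) and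
`e₂(L_P) = e₁(L_P)` (`hord`; evidence: door UG on `O_grow` at `(1,2)`, kit j311095, `h(O_grow,1) = 6` GRH, + Kuroda + the PASS:UNIT
leaves `k, O₁, O₃`, kit j308542 — see the module docstring). CONDITIONAL; nothing booked; (A)/BSD proved for no curve.
[cite: Lim2017FineSelmer, §3 Thm. 3.5 and Lemma 3.2 (arXiv:1306.2047 pp. 6–7)] [cite: Fukuda1994, Thm. 1 (1), p. 264] [cite: Cremona2006, Table 1 (Cremona label 388800ho1)] -/
theorem conjA_g388800ho1_3_lp12
    (hLim : Lim2017.thm35_fineSelmerDual_moduleFinite_of_classicalMuVanishes_of_le_divisionField)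
    (hF1 : fukuda1994_thm1_classNumberPExp_const_of_succ_eq)
    {W : WeierstrassCurve ℚ} [W.IsElliptic] (hWeq : W = (⟨0, 0, 0, (-13500), (-603750)⟩ : WeierstrassCurve ℚ)) (P : W.geomTorsion (3 : ℕ))
    (hram : ∀ κ : ZpExtension ↥(W.unipotentStabilizerField 3 P) 3, κ.IsCyclotomic → TotallyRamifiedFrom κ 0)
    (hord : ∀ κ : ZpExtension ↥(W.unipotentStabilizerField 3 P) 3, κ.IsCyclotomic →
      classNumberPExp κ (1 + 1) = classNumberPExp κ 1)
    (κ : ZpExtension ℚ 3) (hκ : κ.IsCyclotomic) :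
    ∃ (γ : absoluteGaloisGroup ℚ) (Df : W.FineSelmerDualData κ γ),
      Module.Finite ℤ_[3] (RestrictScalars ℤ_[3] (IwasawaAlgebra 3) Df.X) := by
  subst hWeq
  haveI : Fact (Nat.Prime 3) := ⟨Nat.prime_three⟩
  exact Lim2017.fineSelmerDual_moduleFinite_of_classNumberPExp_succ_eq_unipotentStabilizerField hF1 hLim _ 3 (by decide) 1 P hram hord κ hκ

/-- **RECORD — U₀ `ord₃ #Ш(E) ≤ ord₃ #Ш_an(E)` for `E = 388800ho1` with the `μ`-hypothesis DISCHARGED by FUKUDA Thm. 1 (1) at layers `(1,2)` on `L_P`**: named facts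
{A161-fine `hKatoA`, GZK `hGZK`, modularity `hmod`, `hLim`, `hF1`}, Cremona's `r_an = 0` (`hr`), a `3`-torsion point `P` and the displayed numerics `hram` / `hord` of
`L_P = ℚ(E[3])^{U_P}` (evidence: kit j308542 / j311095 + Kuroda, module docstring; GRH through `h(O_grow,1) = 6` only). KERNEL (g18 Rows06):
`E` elliptic, minimal, `ClassO6 E 3`, `E[3]` irreducible. The FIRST U₀ record on this row. Per row; nothing
booked; BSD proved for no curve. [cite: Kato2004Asterisque, Thm. 14.5 (3) (p. 236)] [cite: Lim2017FineSelmer, §3 Thm. 3.5 and Lemma 3.2 (arXiv:1306.2047 pp. 6–7)]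
[cite: Fukuda1994, Thm. 1 (1), p. 264] [cite: Cremona2006, Table 1 (Cremona label 388800ho1)] -/
theorem missingUpperBoundAt_g388800ho1_3_lp12
    (hKatoA : Kato2004.rankZero_padicValNat_sha_add_padicValNat_tamagawa_le_of_additive_potGood_of_irreducible_of_fineSelmerDual_fg)
    (hGZK : rank_eq_analyticRank_of_analyticRank_le_one) (hmod : hasEntireLFunction_rat)
    (hLim : Lim2017.thm35_fineSelmerDual_moduleFinite_of_classicalMuVanishes_of_le_divisionField)
    (hF1 : fukuda1994_thm1_classNumberPExp_const_of_succ_eq)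
    {W : WeierstrassCurve ℚ} [W.IsElliptic] [W.IsGloballyMinimal] (hWeq : W = (⟨0, 0, 0, (-13500), (-603750)⟩ : WeierstrassCurve ℚ))
    (hr : W.analyticRank = 0) (P : W.geomTorsion (3 : ℕ))
    (hram : ∀ κ : ZpExtension ↥(W.unipotentStabilizerField 3 P) 3, κ.IsCyclotomic → TotallyRamifiedFrom κ 0)
    (hord : ∀ κ : ZpExtension ↥(W.unipotentStabilizerField 3 P) 3, κ.IsCyclotomic →
      classNumberPExp κ (1 + 1) = classNumberPExp κ 1) :
    MissingUpperBoundAt W 3 := by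
  subst hWeq
  haveI : Fact (Nat.Prime 3) := ⟨Nat.prime_three⟩
  exact UnitIndexMuDoors.missingUpperBoundAt_three_of_classNumberPExp_succ_eqAt_unipotentStabilizerField _ hKatoA hGZK hmod hLim hF1
    hr classO6_g388800ho1_3 irr_g388800ho1_3 P 1 hram hord

end Summit.BirchSwinnertonDyer.BirchSwinnertonDyer.Theorems.WildUpperUnitTwistRecords

end
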